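import Literature.NumberTheory.DiophantineGeometry.GenEllFullGalois
import Literature.NumberTheory.DiophantineGeometry.GenEllMellLocalHeight
import Literature.NumberTheory.DiophantineGeometry.LocalReductionProofs
import Literature.NumberTheory.EllipticCurves.MazurTorsionPrimeCaseFromCor44Proofs
import HarnessLib

/-!
# [GenEll] §3: local heights and reduction types; `deg_∞ = 0` without multiplicative primes

S. Mochizuki, *Arithmetic elliptic curves in general position*, Math. J. Okayama Univ. **52** (2010)
[cite: MochizukiGenEll2010], Def. 3.3 / Rmk. 3.3.1 (pp. 15–16) and the proof of Lemma 3.7 (p. 18):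

> […] if condition (b) is satisfied, and, moreover `E_L` has no primes of multiplicative reduction
> [so `deg_∞([E_L]) = 0`], then […]

In the tree's rendering (`GenEllMell.lean`, `LocalReduction.lean`) the local height at a finite place
`v` is `h_v = −ord_v(j_E)` (`EllPoint.localHeight`), the reduction type at `v` is that of the chosen
local minimal model (`WeierstrassCurve.HasGoodReductionAt` / `HasMultiplicativeReductionAt`), and
`deg_∞ = [F:ℚ]⁻¹ · log N(𝔇_j)`.  PROVED here (Silverman, *AEC* VII.5.1: for a minimal equation,
good reduction is `v(Δ) = 0`, multiplicative reduction is `v(Δ) > 0 = v(c₄)`, and `j·Δ = c₄³`):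

* `valuation_j_le_one_of_hasGoodReduction_localMinimalModel` — good reduction at `v` ⇒ `|j|_v ≤ 1`;
* `EllPoint.localHeight_pos_of_hasMultiplicativeReductionAt` (`h_v > 0`),
  `EllPoint.localHeight_nonpos_of_hasGoodReductionAt` (`h_v ≤ 0`);
* `EllPoint.degInf_eq_zero_of_not_hasMultPlace` — a semistable curve without primes of
  multiplicative reduction has integral `j`, so `𝔇_j = 𝓞_F` and `deg_∞ = 0`;
* `EllPoint.one_le_degree_mul_degInf_of_hasMultPlace` — with a multiplicative prime,
  `log 2 ≤ [F:ℚ] · deg_∞` ("since `E_L` has at least one prime of bad reduction, it follows that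
  `log(2) ≤ d · deg_∞([E_L])`", p. 19).

Proof-only; no definitions.
-/

noncomputable section

namespace Literature.NumberTheory.DiophantineGeometry.GenEll

open _root_.NumberField _root_.IsDedekindDomain Literature.IUT.LogVolume
open scoped NumberField

section Valuation

variable {A : Type*} [CommRing A] [IsDedekindDomain A] {K : Type*} [Field K] [Algebra A K]
  [IsFractionRing A K]

/-- **`|j(E)|_v ≤ 1` when the local minimal model at `v` has good reduction** (Silverman, *AEC*,
Prop. VII.5.1(a): a minimal equation with good reduction has `v(Δ) = 0`; its coefficients, hence `c₄`,
are `v`-integral, and `j · Δ = c₄³`, so `ord_v(j) = 3·ord_v(c₄) ≥ 0`).  Companion of the tree's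
`one_lt_valuation_j_of_hasMultiplicativeReduction_localMinimalModel` (same conventions: `v` a finite
place of the fraction field `K` of a Dedekind domain `A`, reduction type of `W.localMinimalModel v` over
`O_v`, `j` read in `K`). [cite: SilvermanAEC2009, Prop. VII.5.1(a)] -/
theorem valuation_j_le_one_of_hasGoodReduction_localMinimalModel
    (v : HeightOneSpectrum A) (W : WeierstrassCurve K) [W.IsElliptic]
    (hv : (W.localMinimalModel v).HasGoodReduction (v.adicCompletionIntegers K)) :
    v.valuation K W.j ≤ 1 := by
  haveI := W.isElliptic_localMinimalModel v
  set Kv := v.adicCompletion K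
  set E := W.localMinimalModel v with hE
  haveI : E.IsMinimal (v.adicCompletionIntegers K) := hv.toIsMinimal
  haveI : (W.baseChange Kv).IsElliptic := by
    unfold WeierstrassCurve.baseChange; infer_instance
  -- `j(E) = j(W)` in `K_v`
  have hjE : E.j = algebraMap K Kv W.j := by
    have hC : (((W.baseChange Kv).exists_isMinimal (v.adicCompletionIntegers K)).choose •
        W.baseChange Kv).j = algebraMap K Kv W.j := by
      rw [WeierstrassCurve.variableChange_j]; exact W.map_j _
    exact hC
  have hequiv := WeierstrassCurve.isEquiv_valuation_maximalIdeal_of_le_one_iff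
    (WeierstrassCurve.valued_le_one_iff_mem_range_adicCompletionIntegers v (K := K))
  set w := (IsDiscreteValuationRing.maximalIdeal (v.adicCompletionIntegers K)).valuation Kv
    with hw
  -- `j · Δ = c₄³`, `w(Δ) = 1`, `w(c₄) ≤ 1`
  have key : E.j * E.Δ = E.c₄ ^ 3 := by
    rw [WeierstrassCurve.j, ← WeierstrassCurve.coe_Δ', mul_comm, ← mul_assoc, Units.mul_inv,
      one_mul]
  have hval := congrArg w key
  rw [map_mul, map_pow, hv.goodReduction, mul_one] at hval
  have hc4 : w E.c₄ ≤ 1 := by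
    rw [← WeierstrassCurve.integralModel_c₄_eq (v.adicCompletionIntegers K) E]
    exact HeightOneSpectrum.valuation_le_one _ _
  have hwj : w E.j ≤ 1 := by
    rw [hval]; exact pow_le_one₀ zero_le hc4
  have h2 : Valued.v (algebraMap K Kv W.j) ≤ 1 := by
    rw [← hjE]; exact hequiv.le_one_iff_le_one.mp hwj
  rwa [WeierstrassCurve.valued_algebraMap_adicCompletion] at h2

end Valuation

namespace EllPoint

variable (P : EllPoint)

/-- The local height is the logarithm of the `v`-adic absolute value of `j`:
`h_v = −ord_v(j) = log |j|_v` (in the value group `ℤᵐ⁰` of `v.valuation`).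
[cite: MochizukiGenEll2010, Def 3.3 p.15] -/
theorem localHeight_eq_log (v : HeightOneSpectrum (𝓞 P.F)) :
    P.localHeight v = WithZero.log (v.valuation P.F P.W.j) := by
  simp only [EllPoint.localHeight, ord, neg_neg]

/-- **`h_v > 0` at a prime of multiplicative reduction** ([GenEll] Def. 3.3: the local height
`v_K(q_E) ∈ ℤ_{>0}`; here `|j|_v > 1` by Silverman VII.5.1(b)). [cite: MochizukiGenEll2010, Def 3.3 p.15] -/
theorem localHeight_pos_of_hasMultiplicativeReductionAt (v : HeightOneSpectrum (𝓞 P.F))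
    (hv : P.W.HasMultiplicativeReductionAt v) : 0 < P.localHeight v := by
  have h1 := Literature.NumberTheory.EllipticCurves.one_lt_valuation_j_of_hasMultiplicativeReduction_localMinimalModel
    v P.W hv
  have hj0 : v.valuation P.F P.W.j ≠ 0 := (lt_trans zero_lt_one h1).ne'
  rw [localHeight_eq_log, WithZero.lt_log_iff_exp_lt hj0, WithZero.exp_zero]
  exact h1

/-- **`h_v ≤ 0` at a prime of good reduction** (the paper assigns no local height there; in the
tree's rendering `h_v = −ord_v(j) ≤ 0` since `j` is `v`-integral, Silverman VII.5.1(a)).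
[cite: MochizukiGenEll2010, Rmk 3.3.1 p.16] -/
theorem localHeight_nonpos_of_hasGoodReductionAt (v : HeightOneSpectrum (𝓞 P.F))
    (hv : P.W.HasGoodReductionAt v) : P.localHeight v ≤ 0 := by
  have h1 := valuation_j_le_one_of_hasGoodReduction_localMinimalModel v P.W hv
  rw [localHeight_eq_log]
  by_cases hj0 : v.valuation P.F P.W.j = 0
  · rw [hj0, WithZero.log_zero]
  rw [WithZero.log_le_iff_le_exp hj0, WithZero.exp_zero]
  exact h1

/-- For a semistable curve, a prime that is not of multiplicative reduction is of good reduction.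
[cite: MochizukiGenEll2010, Lem 3.7 p.18] -/
theorem hasGoodReductionAt_of_not_hasMultiplicativeReductionAt (hss : P.IsSemistable)
    (v : HeightOneSpectrum (𝓞 P.F)) (hv : ¬ P.W.HasMultiplicativeReductionAt v) :
    P.W.HasGoodReductionAt v :=
  (hss v).resolve_right hv

/-- **`deg_∞([E_L]) = 0` when the semistable `E_L` has no prime of multiplicative reduction**
([GenEll] proof of Lemma 3.7, p. 18: "[so `deg_∞([E_L]) = 0`]"): every prime is then of good
reduction, `j` is an algebraic integer, `𝔇_j = 𝓞_F`, `N(𝔇_j) = 1`.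
[cite: MochizukiGenEll2010, Lem 3.7 p.18] -/
theorem degInf_eq_zero_of_not_hasMultPlace (hss : P.IsSemistable) (hno : ¬ P.HasMultPlace) :
    P.degInf = 0 := by
  have hle : ∀ v : HeightOneSpectrum (𝓞 P.F), v.valuation P.F P.W.j ≤ 1 := fun v =>
    valuation_j_le_one_of_hasGoodReduction_localMinimalModel v P.W
      (P.hasGoodReductionAt_of_not_hasMultiplicativeReductionAt hss v fun hm => hno ⟨v, hm⟩)
  obtain ⟨b, hb⟩ := HeightOneSpectrum.mem_integers_of_valuation_le_one P.F P.W.j hle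
  have h1 : (1 : 𝓞 P.F) ∈ P.W.jDenominatorIdeal :=
    P.W.one_mem_jDenominatorIdeal_iff.mpr ⟨b, hb.symm⟩
  have htop : P.W.jDenominatorIdeal = ⊤ := (Ideal.eq_top_iff_one _).mpr h1
  simp only [EllPoint.degInf, htop, Ideal.absNorm_top, Nat.cast_one, Real.log_one, mul_zero]

/-- Contrapositive form: if `deg_∞ ≠ 0` (e.g. `> 0`) then a semistable curve has a prime of
multiplicative reduction. [cite: MochizukiGenEll2010, Lem 3.7 p.18] -/
theorem hasMultPlace_of_degInf_ne_zero (hss : P.IsSemistable) (h : P.degInf ≠ 0) :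
    P.HasMultPlace := by
  by_contra hno
  exact h (P.degInf_eq_zero_of_not_hasMultPlace hss hno)

/-- **`log 2 ≤ [F:ℚ] · deg_∞([E_L])` when `E_L` has a prime of multiplicative reduction**
([GenEll] proof of Lemma 3.7, p. 19): the local height there is a positive integer `h_v`, and
`h_v · log 2 ≤ [F:ℚ] · deg_∞` (`localHeight_mul_log_two_le`). [cite: MochizukiGenEll2010, Lem 3.7 p.19] -/
theorem log_two_le_degree_mul_degInf_of_hasMultPlace (h : P.HasMultPlace) :
    Real.log 2 ≤ (P.degree : ℝ) * P.degInf := by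
  obtain ⟨v, hv⟩ := h
  have h1 : (1 : ℝ) ≤ P.localHeight v := by
    exact_mod_cast P.localHeight_pos_of_hasMultiplicativeReductionAt v hv
  have h2 := P.localHeight_mul_log_two_le v
  have hlog : 0 ≤ Real.log 2 := Real.log_nonneg (by norm_num)
  nlinarith

/-- Under "`l` exceeds every local height at the primes of multiplicative reduction" the prime `l`
is prime to those local heights (they are positive integers `< l`).
[cite: MochizukiGenEll2010, Lem 3.7 p.18] -/
theorem not_dvd_localHeight_of_lt {l : ℕ} (v : HeightOneSpectrum (𝓞 P.F))
    (hv : P.W.HasMultiplicativeReductionAt v) (hlt : P.localHeight v < l) :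
    ¬ ((l : ℤ) ∣ P.localHeight v) := by
  intro hdvd
  have hpos := P.localHeight_pos_of_hasMultiplicativeReductionAt v hv
  have := Int.le_of_dvd hpos hdvd
  omega

end EllPoint

end Literature.NumberTheory.DiophantineGeometry.GenEll

end
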